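/-
Copyright: rh-split cell (screw, bridge) gen 19, 2026-08-28.  Splitting search over kernel-typed
RH-equivalences.  A splitting `A ∧ B ⟹ RH` is CONDITIONAL bookkeeping unless `A` and `B` are both
proved; nothing here bears on the truth of RH.
-/
import Summits.RiemannHypothesis.RiemannHypothesis.Theorems.Splittings.ScrewPrimeCellBlindnessC

/-!
# §24 «PRIME-CELL BLINDNESS» — part D of 4: §§9–10 (converse pin, exchange rate)

Carved at section boundaries from the single refereed object `ScrewPrimeCellBlindness.lean`
(rh-split cell (screw, bridge) gen 19; sha16 7ccfa4f57a1815af · 1038 l) to meet the tree line limit;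
the mathematical module docstring of record is in part A (`ScrewPrimeCellBlindnessA`).
HONEST LABEL: kernel algebra about finite prime sums; an INSTRUMENT / barrier note for the screw
column, not a splitting; RH-free; toward RH: 0.  Nothing here bears on the truth of RH.
-/

set_option linter.dupNamespace false

namespace Summit.RiemannHypothesis.RiemannHypothesis.Theorems.Splittings.ScrewPrimeCellBlindness

open Literature.NumberTheory.LFunctions
open Summit.RiemannHypothesis.RiemannHypothesis.Theorems.Splittings.ScrewLatticeContinuation
  (LatticeCeiling)

/-! ## 9. The converse inequality: two consecutive samples pin the fibre to `2ηΔ·m₀(cell)`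

If `w` and `w₀ ≥ 0` give the same samples at two heights `0 ≤ T₀ < T₁` and `|w - w₀| ≤ η w₀` pointwise,
then between the two heights `|φ_w - φ_{w₀}| ≤ 2η(T₁ - T₀)·m₀`, `m₀ = ∑_{e^{T₀} < n ≤ e^{T₁}} w₀(n)/√n`
(`abs_primeSumW_sub_le_of_samples_eq`).  With the matched tents of §7 this makes the fibre oscillation of
the class `{w : |w - Λ| ≤ ηΛ}` over any sample set with local gap `Δ` of exact order `η Δ · m₀ ≍ η Δ² e^{t/2}`. -/

section pin

/-- The part of `φ_δ(T)` carried by the integers of the cell `(e^{T₀}, e^{T}]`. -/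
noncomputable def cellPart (δ : ℕ → ℝ) (T₀ T : ℝ) : ℝ :=
  ∑ n ∈ Finset.Icc 1 ⌊Real.exp T⌋₊ \ Finset.Icc 1 ⌊Real.exp T₀⌋₊, δ n / Real.sqrt n * (T - Real.log n)

/-- The zeroth moment of `w₀` over the cell `(e^{T₀}, e^{T₁}]`. -/
noncomputable def cellMass (w₀ : ℕ → ℝ) (T₀ T₁ : ℝ) : ℝ :=
  ∑ n ∈ Finset.Icc 1 ⌊Real.exp T₁⌋₊ \ Finset.Icc 1 ⌊Real.exp T₀⌋₊, w₀ n / Real.sqrt n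

/-- Monotonicity of the counting range: `T₀ ≤ T` gives `Icc 1 ⌊e^{T₀}⌋ ⊆ Icc 1 ⌊e^{T}⌋`. -/
theorem Icc_floor_exp_subset {T₀ T : ℝ} (h : T₀ ≤ T) :
    Finset.Icc 1 ⌊Real.exp T₀⌋₊ ⊆ Finset.Icc 1 ⌊Real.exp T⌋₊ :=
  Finset.Icc_subset_Icc_right (Nat.floor_mono (Real.exp_le_exp.2 h))

/-- Membership in the cell `(e^{T₀}, e^{T}]` forces `T₀ < log n ≤ T`. -/
theorem log_mem_of_mem_sdiff {T₀ T : ℝ} {n : ℕ}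
    (hn : n ∈ Finset.Icc 1 ⌊Real.exp T⌋₊ \ Finset.Icc 1 ⌊Real.exp T₀⌋₊) :
    T₀ < Real.log n ∧ Real.log n ≤ T := by
  rw [Finset.mem_sdiff, Finset.mem_Icc, Finset.mem_Icc, not_and, not_le] at hn
  have hn1 : 1 ≤ n := hn.1.1
  have hn0 : (0 : ℝ) < n := by exact_mod_cast hn1
  refine ⟨?_, ?_⟩
  · have hlt : ⌊Real.exp T₀⌋₊ < n := hn.2 hn1
    rw [Real.lt_log_iff_exp_lt hn0]
    exact (Nat.floor_lt (Real.exp_pos _).le).1 hlt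
  · rw [Real.log_le_iff_le_exp hn0]
    exact (Nat.le_floor_iff (Real.exp_pos _).le).1 hn.1.2

/-- Splitting `φ_δ(T)` at a height `0 ≤ T₀ ≤ T`: the integers `≤ e^{T₀}` contribute through the two
moments at `T₀`, the cell `(e^{T₀}, e^{T}]` contributes `cellPart`. -/
theorem primeSumW_eq_moments_add_cellPart (δ : ℕ → ℝ) {T₀ T : ℝ} (hT₀ : 0 ≤ T₀) (hT : T₀ ≤ T) :
    primeSumW δ T = T * moment0 δ T₀ - moment1 δ T₀ + cellPart δ T₀ T := by
  have haT : |T| = T := abs_of_nonneg (hT₀.trans hT)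
  have haT₀ : |T₀| = T₀ := abs_of_nonneg hT₀
  simp only [primeSumW, moment0, moment1, cellPart, haT, haT₀]
  rw [← Finset.sum_sdiff (Icc_floor_exp_subset hT), Finset.mul_sum, ← Finset.sum_sub_distrib]
  have : ∑ n ∈ Finset.Icc 1 ⌊Real.exp T₀⌋₊, δ n / Real.sqrt n * (T - Real.log n) =
      ∑ n ∈ Finset.Icc 1 ⌊Real.exp T₀⌋₊, (T * (δ n / Real.sqrt n) - δ n / Real.sqrt n * Real.log n) :=
    Finset.sum_congr rfl fun n _ ↦ by ring
  rw [this]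
  ring

/-- `φ_{w - w₀} = φ_w - φ_{w₀}`. -/
theorem primeSumW_sub (w w₀ : ℕ → ℝ) (t : ℝ) :
    primeSumW (fun n ↦ w n - w₀ n) t = primeSumW w t - primeSumW w₀ t := by
  simp only [primeSumW, ← Finset.sum_sub_distrib]
  exact Finset.sum_congr rfl fun n _ ↦ by ring

/-- `φ_w(|t|) = φ_w(t)`. -/
theorem primeSumW_abs (w : ℕ → ℝ) (t : ℝ) : primeSumW w |t| = primeSumW w t := by
  simp only [primeSumW, abs_abs]

/-- The cell part is controlled by the cell mass: `|cellPart δ T₀ T| ≤ (T - T₀) η m₀(T₀, T₁)`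
for `|δ| ≤ η w₀`, `w₀ ≥ 0`, `η ≥ 0`, `T₀ ≤ T ≤ T₁`. -/
theorem abs_cellPart_le {δ w₀ : ℕ → ℝ} {η T₀ T T₁ : ℝ} (hη : 0 ≤ η) (hw₀ : ∀ n, 0 ≤ w₀ n)
    (hδ : ∀ n, |δ n| ≤ η * w₀ n) (hT : T₀ ≤ T) (hT₁ : T ≤ T₁) :
    |cellPart δ T₀ T| ≤ (T - T₀) * η * cellMass w₀ T₀ T₁ := by
  unfold cellPart cellMass
  refine (Finset.abs_sum_le_sum_abs _ _).trans ?_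
  calc ∑ n ∈ Finset.Icc 1 ⌊Real.exp T⌋₊ \ Finset.Icc 1 ⌊Real.exp T₀⌋₊,
        |δ n / Real.sqrt n * (T - Real.log n)|
      ≤ ∑ n ∈ Finset.Icc 1 ⌊Real.exp T⌋₊ \ Finset.Icc 1 ⌊Real.exp T₀⌋₊,
          (T - T₀) * η * (w₀ n / Real.sqrt n) := by
        refine Finset.sum_le_sum fun n hn ↦ ?_
        obtain ⟨h1, h2⟩ := log_mem_of_mem_sdiff hn
        rw [abs_mul, abs_div, abs_of_nonneg (Real.sqrt_nonneg _),
          abs_of_nonneg (sub_nonneg.2 h2)]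
        have hq : |δ n| / Real.sqrt n ≤ η * w₀ n / Real.sqrt n :=
          div_le_div_of_nonneg_right (hδ n) (Real.sqrt_nonneg _)
        have hq0 : 0 ≤ |δ n| / Real.sqrt n := div_nonneg (abs_nonneg _) (Real.sqrt_nonneg _)
        calc |δ n| / Real.sqrt n * (T - Real.log n)
            ≤ (η * w₀ n / Real.sqrt n) * (T - T₀) :=
              mul_le_mul hq (by linarith) (sub_nonneg.2 h2) (hq0.trans hq)
          _ = (T - T₀) * η * (w₀ n / Real.sqrt n) := by ring
    _ ≤ ∑ n ∈ Finset.Icc 1 ⌊Real.exp T₁⌋₊ \ Finset.Icc 1 ⌊Real.exp T₀⌋₊,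
          (T - T₀) * η * (w₀ n / Real.sqrt n) := by
        refine Finset.sum_le_sum_of_subset_of_nonneg
          (Finset.sdiff_subset_sdiff (Icc_floor_exp_subset hT₁) le_rfl) fun n _ _ ↦ ?_
        exact mul_nonneg (mul_nonneg (sub_nonneg.2 hT) hη) (div_nonneg (hw₀ n) (Real.sqrt_nonneg _))
    _ = (T - T₀) * η * ∑ n ∈ Finset.Icc 1 ⌊Real.exp T₁⌋₊ \ Finset.Icc 1 ⌊Real.exp T₀⌋₊,
          w₀ n / Real.sqrt n := by rw [Finset.mul_sum]

/-- **Two equal samples pin the fibre**: if `φ_w = φ_{w₀}` at the heights `T₀ < T₁` (`T₀ ≥ 0`), `w₀ ≥ 0`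
and `|w - w₀| ≤ η w₀` pointwise (`η ≥ 0`), then for `T₀ ≤ |t| ≤ T₁`
`|φ_w(t) - φ_{w₀}(t)| ≤ 2η(T₁ - T₀) · ∑_{e^{T₀} < n ≤ e^{T₁}} w₀(n)/√n`. -/
theorem abs_primeSumW_sub_le_of_samples_eq {w w₀ : ℕ → ℝ} {η T₀ T₁ : ℝ} (hη : 0 ≤ η)
    (hw₀ : ∀ n, 0 ≤ w₀ n) (hδ : ∀ n, |w n - w₀ n| ≤ η * w₀ n) (hT₀ : 0 ≤ T₀) (hT : T₀ < T₁)
    (h0 : primeSumW w T₀ = primeSumW w₀ T₀) (h1 : primeSumW w T₁ = primeSumW w₀ T₁) {t : ℝ}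
    (ht₀ : T₀ ≤ |t|) (ht₁ : |t| ≤ T₁) :
    |primeSumW w t - primeSumW w₀ t| ≤ 2 * η * (T₁ - T₀) * cellMass w₀ T₀ T₁ := by
  set δ : ℕ → ℝ := fun n ↦ w n - w₀ n with hδdef
  have hsub : ∀ s, primeSumW w s - primeSumW w₀ s = primeSumW δ s :=
    fun s ↦ (primeSumW_sub w w₀ s).symm
  have hδ' : ∀ n, |δ n| ≤ η * w₀ n := hδ
  -- the three splittings
  have eT₀ := primeSumW_eq_moments_add_cellPart δ hT₀ le_rfl
  have eT₁ := primeSumW_eq_moments_add_cellPart δ hT₀ hT.le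
  have eT := primeSumW_eq_moments_add_cellPart δ hT₀ ht₀
  have hP₀ : cellPart δ T₀ T₀ = 0 := by simp [cellPart]
  have hz₀ : primeSumW δ T₀ = 0 := by rw [← hsub, h0, sub_self]
  have hz₁ : primeSumW δ T₁ = 0 := by rw [← hsub, h1, sub_self]
  rw [hz₀, hP₀, add_zero] at eT₀
  rw [hz₁] at eT₁
  -- eliminate the two moments
  have hM₁ : moment1 δ T₀ = T₀ * moment0 δ T₀ := by linarith
  have hM₀ : (T₁ - T₀) * moment0 δ T₀ = -cellPart δ T₀ T₁ := by
    rw [hM₁] at eT₁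
    linarith
  have habs : primeSumW w t - primeSumW w₀ t = primeSumW δ |t| := by
    rw [hsub, primeSumW_abs]
  have hne : T₁ - T₀ ≠ 0 := by linarith
  -- work with `T = |t|` to keep the absolute-value bars readable
  generalize hTdef : |t| = T at ht₀ ht₁ habs eT
  have key : primeSumW δ T =
      cellPart δ T₀ T - (T - T₀) / (T₁ - T₀) * cellPart δ T₀ T₁ := by
    rw [eT, hM₁]
    have : moment0 δ T₀ = -cellPart δ T₀ T₁ / (T₁ - T₀) := by
      field_simp
      linarith
    rw [this]
    field_simp
    ring
  rw [habs, key]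
  have bP := abs_cellPart_le hη hw₀ hδ' ht₀ ht₁
  have bP₁ := abs_cellPart_le hη hw₀ hδ' hT.le le_rfl
  have hm : 0 ≤ cellMass w₀ T₀ T₁ :=
    Finset.sum_nonneg fun n _ ↦ div_nonneg (hw₀ n) (Real.sqrt_nonneg _)
  have hfrac : 0 ≤ (T - T₀) / (T₁ - T₀) := div_nonneg (by linarith) (by linarith)
  calc |cellPart δ T₀ T - (T - T₀) / (T₁ - T₀) * cellPart δ T₀ T₁|
      ≤ |cellPart δ T₀ T| + |(T - T₀) / (T₁ - T₀) * cellPart δ T₀ T₁| := abs_sub _ _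
    _ = |cellPart δ T₀ T| + (T - T₀) / (T₁ - T₀) * |cellPart δ T₀ T₁| := by
        rw [abs_mul, abs_of_nonneg hfrac]
    _ ≤ (T - T₀) * η * cellMass w₀ T₀ T₁ +
          (T - T₀) / (T₁ - T₀) * ((T₁ - T₀) * η * cellMass w₀ T₀ T₁) := by
        gcongr
    _ = 2 * η * (T - T₀) * cellMass w₀ T₀ T₁ := by
        field_simp
        ring
    _ ≤ 2 * η * (T₁ - T₀) * cellMass w₀ T₀ T₁ := by
        have h' : T - T₀ ≤ T₁ - T₀ := by linarith
        nlinarith [mul_le_mul_of_nonneg_right h' (mul_nonneg hη hm), mul_nonneg hη hm]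

/-- Lattice form: a lattice-blind `w` with `|w - w₀| ≤ η w₀` stays within `2η h · m₀(cell)` of `φ_{w₀}`
in every cell `[kh, (k+1)h]`. -/
theorem abs_primeSumW_sub_le_of_lattice {w w₀ : ℕ → ℝ} {η h : ℝ} (hη : 0 ≤ η) (hh : 0 < h)
    (hw₀ : ∀ n, 0 ≤ w₀ n) (hδ : ∀ n, |w n - w₀ n| ≤ η * w₀ n)
    (hblind : ∀ j : ℕ, primeSumW w (j * h) = primeSumW w₀ (j * h)) (k : ℕ) {t : ℝ}
    (ht₀ : k * h ≤ |t|) (ht₁ : |t| ≤ (k + 1) * h) :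
    |primeSumW w t - primeSumW w₀ t| ≤ 2 * η * h * cellMass w₀ (k * h) ((k + 1) * h) := by
  have e : ((k + 1 : ℕ) : ℝ) * h = (k + 1) * h := by push_cast; ring
  have h1 := hblind (k + 1)
  rw [e] at h1
  have hk0 : (0 : ℝ) ≤ k * h := by positivity
  have hlt : (k : ℝ) * h < (k + 1) * h := by linarith
  have := abs_primeSumW_sub_le_of_samples_eq hη hw₀ hδ hk0 hlt (hblind k) h1 ht₀ ht₁
  have hsub : ((k : ℝ) + 1) * h - k * h = h := by ring
  rw [hsub] at this
  exact this

/-- The screw reading of the pin: a lattice-blind `w` in the class `|w - Λ| ≤ ηΛ` moves `Ψ` off the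
lattice by at most `2η h · m₀(cell)`. -/
theorem abs_screwW_sub_zetaScrew_le_of_lattice {w : ℕ → ℝ} {η h : ℝ} (hη : 0 ≤ η) (hh : 0 < h)
    (hδ : ∀ n, |w n - ArithmeticFunction.vonMangoldt n| ≤ η * ArithmeticFunction.vonMangoldt n)
    (hblind : ∀ j : ℕ, primeSumW w (j * h) = zetaScrewPrimeSum (j * h)) (k : ℕ) {t : ℝ}
    (ht₀ : k * h ≤ |t|) (ht₁ : |t| ≤ (k + 1) * h) :
    |screwW w t - zetaScrew t| ≤
      2 * η * h * cellMass (fun n ↦ ArithmeticFunction.vonMangoldt n) (k * h) ((k + 1) * h) := by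
  have hw₀ : ∀ n : ℕ, 0 ≤ (ArithmeticFunction.vonMangoldt n : ℝ) :=
    fun n ↦ ArithmeticFunction.vonMangoldt_nonneg
  have hblind' : ∀ j : ℕ, primeSumW w (j * h) =
      primeSumW (fun n ↦ ArithmeticFunction.vonMangoldt n) (j * h) := by
    intro j; rw [hblind j, ← primeSumW_vonMangoldt]
  have := abs_primeSumW_sub_le_of_lattice hη hh hw₀ hδ hblind' k ht₀ ht₁
  have e : screwW w t - zetaScrew t =
      -(primeSumW w t - primeSumW (fun n ↦ ArithmeticFunction.vonMangoldt n) t) := by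
    rw [screwW, primeSumW_vonMangoldt]; ring
  rw [e, abs_neg]
  exact this

end pin


/-! ## 10. Book-keeping of the exchange rate

Two elementary companions of §9: the lattice-blindness CRITERION in moment form (`primeSumW_eq_iff_moments`:
`φ_w(t) = φ_{w'}(t) ↔ |t|·ΔM₀(t) = ΔM₁(t)`), and the bound that uses NO samples at all
(`abs_primeSumW_sub_le_mul_self`: `|φ_w - φ_{w₀}| ≤ η φ_{w₀}` pointwise for `|w - w₀| ≤ η w₀`).  Against
`φ(t) = 4e^{t/2} + O(e^{t/2 - c√t})` (Suzuki 2023 Prop. 2.1) and `m₀(cell) ≍ h e^{t/2}`, the lattice data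
improve the a-priori `η`-class uncertainty `≍ 4η e^{t/2}` only to `2η h² e^{t/2}`: a constant factor, no exponent. -/

section rate

/-- Lattice-blindness criterion in moment form: `φ_w(t) = φ_{w'}(t) ↔ |t| (M₀ w t - M₀ w' t) = M₁ w t - M₁ w' t`. -/
theorem primeSumW_eq_iff_moments (w w' : ℕ → ℝ) (t : ℝ) :
    primeSumW w t = primeSumW w' t ↔
      |t| * (moment0 w t - moment0 w' t) = moment1 w t - moment1 w' t := by
  rw [primeSumW_eq_moments, primeSumW_eq_moments]
  constructor <;> intro h <;> linarith

/-- `φ_{w₀} ≥ 0` for `w₀ ≥ 0`. -/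
theorem primeSumW_nonneg {w₀ : ℕ → ℝ} (hw₀ : ∀ n, 0 ≤ w₀ n) (t : ℝ) : 0 ≤ primeSumW w₀ t := by
  unfold primeSumW
  refine Finset.sum_nonneg fun n hn ↦ ?_
  have hn1 : 1 ≤ n := (Finset.mem_Icc.1 hn).1
  have hlog : Real.log n ≤ |t| := (mem_Icc_floor_exp_iff hn1 t).1 hn
  exact mul_nonneg (div_nonneg (hw₀ n) (Real.sqrt_nonneg _)) (by linarith)

/-- The sample-free bound: `|φ_w(t) - φ_{w₀}(t)| ≤ η φ_{w₀}(t)` whenever `|w - w₀| ≤ η w₀` pointwise. -/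
theorem abs_primeSumW_sub_le_mul_self {w w₀ : ℕ → ℝ} {η : ℝ}
    (hδ : ∀ n, |w n - w₀ n| ≤ η * w₀ n) (t : ℝ) :
    |primeSumW w t - primeSumW w₀ t| ≤ η * primeSumW w₀ t := by
  rw [← primeSumW_sub]
  unfold primeSumW
  rw [Finset.mul_sum]
  refine (Finset.abs_sum_le_sum_abs _ _).trans (Finset.sum_le_sum fun n hn ↦ ?_)
  have hn1 : 1 ≤ n := (Finset.mem_Icc.1 hn).1
  have hlog : Real.log n ≤ |t| := (mem_Icc_floor_exp_iff hn1 t).1 hn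
  have ht : 0 ≤ |t| - Real.log n := by linarith
  rw [abs_mul, abs_div, abs_of_nonneg (Real.sqrt_nonneg _), abs_of_nonneg ht]
  calc |w n - w₀ n| / Real.sqrt n * (|t| - Real.log n)
      ≤ η * w₀ n / Real.sqrt n * (|t| - Real.log n) :=
        mul_le_mul_of_nonneg_right (div_le_div_of_nonneg_right (hδ n) (Real.sqrt_nonneg _)) ht
    _ = η * (w₀ n / Real.sqrt n * (|t| - Real.log n)) := by ring

/-- Screw reading of the sample-free bound: `|Ψ_w(t) - Ψ(t)| ≤ η φ(t)` for `|w - Λ| ≤ ηΛ`. -/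
theorem abs_screwW_sub_zetaScrew_le_mul_primeSum {w : ℕ → ℝ} {η : ℝ}
    (hδ : ∀ n, |w n - ArithmeticFunction.vonMangoldt n| ≤ η * ArithmeticFunction.vonMangoldt n) (t : ℝ) :
    |screwW w t - zetaScrew t| ≤ η * zetaScrewPrimeSum t := by
  have := abs_primeSumW_sub_le_mul_self hδ t
  rw [primeSumW_vonMangoldt] at this
  have e : screwW w t - zetaScrew t = -(primeSumW w t - zetaScrewPrimeSum t) := by
    rw [screwW]; ring
  rwa [e, abs_neg]

end rate

end Summit.RiemannHypothesis.RiemannHypothesis.Theorems.Splittings.ScrewPrimeCellBlindness
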